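import Literature.NumberTheory.Automorphic.ShimuraParametrizationSplitCaseProofs
import Literature.NumberTheory.EllipticCurves.ModularParametrizationTrustBaseProofs
import HarnessLib

/-!
# `nonempty_shimuraParametrizationData` RELATIVE TO MODULARITY: the Jacquet–Langlands step
# isolated, and proved at `D = 1`

Topic `Literature/NumberTheory/Automorphic`; a proofs-only sibling (theorems only; no definition,
no named fact) of `ShimuraCurveRibetTakahashi.lean`, continuing
`ShimuraParametrizationExistenceProofs`, `ShimuraCurveMapDegreeProofs` and
`ShimuraParametrizationSplitCaseProofs`.

The review of 2026-08-16 recorded in the docstring of the named fact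
`Literature.NumberTheory.Automorphic.nonempty_shimuraParametrizationData` (Pasten §2 p. 12:
"the modularity theorem … associates to `E` a unique … `f` … More generally, for each admissible
factorization `N = DM`, the Jacquet–Langlands correspondence gives an optimal quotient
`q_{D,M} : J₀^D(M) → A_{D,M}` defined over `ℚ`, with `A_{D,M}` isogenous to `E`") proposes its
**relative form**: "relative to the modularity of `W` (a hypothesis
`Nonempty (ModularParametrizationData W N)`, `[NeZero N]`, inserted before the conclusion …) the
fact records the Jacquet–Langlands step alone, as the source attributes it, and the absolute form
is the relative one applied to `nonempty_modularParametrizationData`". This file makes that re-cut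
available as THEOREMS, without touching the fact or its consumers:

* `ShimuraParametrizationData.nonempty_of_automorphicHalf` — the pointwise constructor: a datum of
  `W` on `X` from a weight-`2` form on `X.Gamma` with periods in a Néron-type lattice `Λ_L`, in the
  Hecke line of `W`, with a positive degree and its cofinite fibre count on `ℂ/Λ_L` (uniformisation
  `ℂ/Λ_L ≅ W(ℂ)` by the tree's `PeriodPair.exists_addMonoidHom_of_g₂_g₃'`, AEC VI.3.6(b)).
* `ShimuraParametrizationData.nonempty_of_eigenform` — for `D > 1`: a datum from a NON-ZERO
  eigenform with Néron periods alone (the degree by `ShimuraCurveData.exists_deg_of_hasPeriodsIn`,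
  compactness of `X₀^D(M)(ℂ)`).
* `nonempty_shimuraParametrizationData_one_of_modularParametrizationData` — **the relative form
  at `D = 1`, PROVED**: every modular parametrisation datum `D₁ : ModularParametrizationData W M`
  transports to a Shimura-curve datum of `W` on EVERY presentation `X : ShimuraCurveData 1 M` of
  `X₀(M)` (`automorphicHalf_one_of_isNewformOf` with `c = D₁.c ≠ 0`,
  `maninConstant_ne_zero_holds`). No hypothesis on `W` beyond ellipticity.
* `relative_of_eigenform` — the relative form at every admissible `(N, D, M)` from the `D > 1`
  Jacquet–Langlands eigenform hypothesis `hJL` of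
  `nonempty_shimuraParametrizationData_of_exists_isNewformOf` (so the relative form and `hJL`
  have the same open content: Jacquet–Langlands with Shimura's construction on `X₀^D(M)`,
  Darmon 2004 Thm. 4.13 and §4.6, Pasten §4.10–4.11).
* `nonempty_shimuraParametrizationData_of_relative`,
  `nonempty_shimuraParametrizationData_of_relative_of_exists_isNewformOf` — the absolute fact =
  the relative form + `nonempty_modularParametrizationData`, = the relative form +
  `exists_isNewformOf` (the tree's `nonempty_modularParametrizationData_of_exists_isNewformOf`
  with the discharged `IsNewformOf.exists_maninConstant_ne_zero_holds`); and
  `relative_of_nonempty_shimuraParametrizationData` (the converse bookkeeping). Composing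
  `relative_of_eigenform` with `…_of_relative_of_exists_isNewformOf` returns the tree's
  `nonempty_shimuraParametrizationData_of_exists_isNewformOf` (`ShimuraParametrizationSplitCaseProofs`).

What remains open is therefore named precisely: the Modularity theorem (`exists_isNewformOf`, the
tree's root fact) and, for `D > 1` only, the Jacquet–Langlands eigenform with Néron periods
(`hJL`; Darmon 2004 Thm. 4.13 with §4.6 — no statement of the tree; a proving seat may not vendor
it, D-0026).

## References

* H. Pasten, *Shimura curves and the abc conjecture*, J. Number Theory 254 (2024) =
  arXiv:1705.09251, §2 p. 12, §4.10–4.11 p. 16, Prop. 5.1 p. 17. [PastenShimura2024]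
* H. Darmon, *Rational Points on Modular Elliptic Curves*, CBMS 101 (2004), Thm. 4.13, §4.6.
  [Darmon2004]
* C. Breuil, B. Conrad, F. Diamond, R. Taylor, J. Amer. Math. Soc. 14 (2001), Thm. A. [BCDTJAMS2001]
* J. H. Silverman, *The Arithmetic of Elliptic Curves*, VI.3.6, VI.5.1. [SilvermanAEC2009]
-/

noncomputable section

open scoped MatrixGroups ModularForm
open UpperHalfPlane CongruenceSubgroup

namespace Literature.NumberTheory.Automorphic

open Literature.NumberTheory.EllipticCurves.ModularForms

/-! ### Pointwise constructors of a datum -/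

namespace ShimuraParametrizationData

variable {D M : ℕ} (X : ShimuraCurveData D M) (W : WeierstrassCurve ℚ)

/-- **A datum from its automorphic half (pointwise).** Given a Néron-type period pair `L` of `W`
and a weight-`2` form `h` on `Γ₀^D(M)` with periods in `Λ_L`, `T_ℓ h = a_ℓ(W) h` for primes
`ℓ ∤ D M`, a base point `τ₀` and a degree `d ≥ 1` with cofinitely many classes of `ℂ/Λ_L` having
exactly `d` orbits `Γτ` with `∫_{τ₀}^τ h` in the class, there is a datum of `W` on `X`: the
uniformisation `ℂ →+ W(ℂ)` with kernel `Λ_L` exists (`PeriodPair.exists_addMonoidHom_of_g₂_g₃'`,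
AEC VI.3.6(b)) and the fibre count is transported along `ℂ/Λ_L ≃ W(ℂ)`
(`finite_setOf_card_orbitFibre_ne_iff`) — the pointwise body of the tree's
`nonempty_shimuraParametrizationData_of_automorphicHalf`. [cite: SilvermanAEC2009, Prop. VI.3.6(b)] -/
theorem nonempty_of_automorphicHalf {L : PeriodPair} (hL : IsNeronLatticeOf (W.baseChange ℂ) L)
    (H : ∃ (h : CuspForm X.Gamma 2) (τ₀ : ℍ) (d : ℕ),
      HasPeriodsIn X.Gamma h (L.lattice : Set ℂ) ∧
      (∀ ℓ : ℕ, ℓ.Prime → ¬ ℓ ∣ D * M →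
        X.heckeFun ℓ h = fun τ => ((W.LFunction ℓ : ℤ) : ℂ) * h τ) ∧
      0 < d ∧
      {c : ℂ ⧸ L.lattice.toAddSubgroup |
        Nat.card {y : MulAction.orbitRel.Quotient X.Gamma ℍ // ∃ τ : ℍ,
          (Quotient.mk _ τ : MulAction.orbitRel.Quotient X.Gamma ℍ) = y ∧
            ((segmentIntegral h τ₀ τ : ℂ) : ℂ ⧸ L.lattice.toAddSubgroup) = c} ≠ d}.Finite) :
    Nonempty (ShimuraParametrizationData X W) := by
  obtain ⟨u, hker, hsurj, hspec⟩ := PeriodPair.exists_addMonoidHom_of_g₂_g₃' hL.1 hL.2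
  obtain ⟨h, τ₀, d, hper, hhecke, hd, hfin⟩ := H
  have hker' : L.lattice.toAddSubgroup = u.ker :=
    SetLike.coe_injective (by rw [Submodule.coe_toAddSubgroup, hker])
  let e : ℂ ⧸ L.lattice.toAddSubgroup ≃+ (W.baseChange ℂ).toAffine.Point :=
    QuotientAddGroup.liftEquiv L.lattice.toAddSubgroup hsurj hker'
  have he : ∀ x : ℂ, e.toEquiv (x : ℂ ⧸ L.lattice.toAddSubgroup) = u x := fun _ ↦ rfl
  have key := (finite_setOf_card_orbitFibre_ne_iff
    (fun τ : ℍ ↦ (Quotient.mk _ τ : MulAction.orbitRel.Quotient X.Gamma ℍ)) e.toEquiv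
    (fun τ : ℍ ↦ ((segmentIntegral h τ₀ τ : ℂ) : ℂ ⧸ L.lattice.toAddSubgroup)) d).mpr hfin
  simp only [he] at key
  exact ⟨{
    L := L
    isNeronLattice := hL
    uniformize := u
    ker_uniformize := hker
    uniformize_surjective := hsurj
    uniformize_spec := hspec
    form := h
    basePoint := τ₀
    period_mem := hper
    hecke_eq := hhecke
    deg := d
    deg_pos := hd
    deg_spec := key }⟩

/-- **A datum from a non-zero eigenform with Néron periods, `D > 1` (pointwise).** For `D > 1`
the curve `Γ₀^D(M)∖ℍ` is compact, so a non-zero weight-`2` form `h` with periods in `Λ_L` has a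
degree `d ≥ 1` with a cofinite fibre count (`ShimuraCurveData.exists_deg_of_hasPeriodsIn`, the
degree of a non-constant holomorphic map of compact Riemann surfaces — Pasten, proof of
Prop. 5.1 p. 17); with the Hecke condition this is a datum (`nonempty_of_automorphicHalf`).
[cite: PastenShimura2024, proof of Prop. 5.1 p. 17] -/
theorem nonempty_of_eigenform (hD : 1 < D) {L : PeriodPair}
    (hL : IsNeronLatticeOf (W.baseChange ℂ) L) (h : CuspForm X.Gamma 2) (hh : (⇑h : ℍ → ℂ) ≠ 0)
    (hper : HasPeriodsIn X.Gamma h (L.lattice : Set ℂ))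
    (hhecke : ∀ ℓ : ℕ, ℓ.Prime → ¬ ℓ ∣ D * M →
      X.heckeFun ℓ h = fun τ => ((W.LFunction ℓ : ℤ) : ℂ) * h τ) :
    Nonempty (ShimuraParametrizationData X W) := by
  obtain ⟨d, hd, hfin⟩ := X.exists_deg_of_hasPeriodsIn hD h hh L hper UpperHalfPlane.I
  exact nonempty_of_automorphicHalf X W hL ⟨h, UpperHalfPlane.I, d, hper, hhecke, hd, hfin⟩

end ShimuraParametrizationData

/-! ### The relative form at `D = 1` is a theorem -/

section SplitCase

/-- **Every modular parametrisation transports to every presentation of `X₀(M)`** — the relative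
form of `nonempty_shimuraParametrizationData` at `D = 1`, PROVED: for a datum
`D₁ : ModularParametrizationData W M` (the newform `f = D₁.f` of `W` at level `M`, the Néron-type
period pair `D₁.L`, the Manin constant `c = D₁.c` with `c Λ_f ⊆ Λ_L`, `c ≠ 0` by the tree's
`maninConstant_ne_zero_holds`) and ANY `X : ShimuraCurveData 1 M` (an Eichler order `O` of level
`M` in a split `B/ℚ` with a real embedding `ι`), the form `c · 2πi · (f ∣[2] h⁻¹)` on
`X.Gamma = h Γ₀(M)± h⁻¹` (`det h > 0`) has periods in `Λ_L`, lies in the Hecke line of `W` and has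
the fibre count of the classical map on `Y₀(M)` (`automorphicHalf_one_of_isNewformOf`); the
uniformisation is re-supplied by `ShimuraParametrizationData.nonempty_of_automorphicHalf`. The
split case of Pasten's `q_{1,N} j_N` (§2 p. 12) for an arbitrary presentation `(B, O, ι)`.
[cite: PastenShimura2024, §2 p. 12 and §5.3 p. 17] -/
theorem nonempty_shimuraParametrizationData_one_of_modularParametrizationData {M : ℕ} [NeZero M]
    (X : ShimuraCurveData 1 M) (W : WeierstrassCurve ℚ)
    (D₁ : ModularParametrizationData W M) : Nonempty (ShimuraParametrizationData X W) :=
  ShimuraParametrizationData.nonempty_of_automorphicHalf X W D₁.isNeronLattice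
    (automorphicHalf_one_of_isNewformOf X W D₁.isNewformOf D₁.maninConstant_ne_zero_holds
      D₁.smul_periodLattice_le)

/-- The same with the level of the modular parametrisation datum given as the admissible level
`N = 1 · M` (the shape in which the relative form quantifies). [cite: PastenShimura2024, §2 p. 12] -/
theorem nonempty_shimuraParametrizationData_one_of_modularParametrizationData' {N M : ℕ} [NeZero N]
    (hNDM : IsAdmissibleFactorization N 1 M) (X : ShimuraCurveData 1 M) (W : WeierstrassCurve ℚ)
    (D₁ : ModularParametrizationData W N) :
    Nonempty (ShimuraParametrizationData X W) := by
  have hMN : N = M := by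
    have := hNDM.mul_eq
    rw [one_mul] at this
    exact this.symm
  subst hMN
  exact nonempty_shimuraParametrizationData_one_of_modularParametrizationData X W D₁

end SplitCase

/-! ### The relative form: from the `D > 1` eigenform hypothesis, and back to the fact -/

section Relative

/-- **The relative form of `nonempty_shimuraParametrizationData` from the `D > 1`
Jacquet–Langlands eigenform.** Hypothesis `hJL` (as in
`nonempty_shimuraParametrizationData_of_exists_isNewformOf`): for `1 < D`, every datum `X` of level
`(D, M)`, every globally minimal elliptic `W/ℚ` of conductor `D M` and every Néron-type `L`, a
non-zero `h ∈ S₂(Γ₀^D(M))` with periods in `Λ_L` and `T_ℓ h = a_ℓ(W) h` (`ℓ ∤ D M`) — Darmon 2004,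
Thm. 4.13 with §4.6 (Jacquet–Langlands, Thm. 4.12; the Eichler–Shimura quotient `E_f` of
`J_{N⁺,N⁻}`, Thm. 4.11; an isogeny `E_f → E`), Pasten §4.10–4.11. Conclusion: the relative form —
for every admissible `N = D M`, datum `X`, globally minimal elliptic `W` of conductor `N` ADMITTING
A MODULAR PARAMETRISATION at level `N`, a Shimura-curve datum of `W` on `X` exists. At `D = 1` the
hypothesis is not used (`nonempty_shimuraParametrizationData_one_of_modularParametrizationData'`);
at `D > 1` the modular parametrisation is not used beyond its existence (the eigenform carries the
arithmetic). [cite: Darmon2004, Thm. 4.13 and §4.6] [cite: PastenShimura2024, §2 p. 12 and §4.10–4.11 p. 16] -/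
theorem relative_of_eigenform
    (hJL : ∀ {N D M : ℕ}, IsAdmissibleFactorization N D M → 1 < D →
      ∀ (X : ShimuraCurveData D M) (W : WeierstrassCurve ℚ) [W.IsElliptic] [W.IsGloballyMinimal],
        W.conductorNorm ℤ = N → ∀ {L : PeriodPair}, IsNeronLatticeOf (W.baseChange ℂ) L →
        ∃ h : CuspForm X.Gamma 2, (⇑h : ℍ → ℂ) ≠ 0 ∧
          HasPeriodsIn X.Gamma h (L.lattice : Set ℂ) ∧
          ∀ ℓ : ℕ, ℓ.Prime → ¬ ℓ ∣ D * M →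
            X.heckeFun ℓ h = fun τ => ((W.LFunction ℓ : ℤ) : ℂ) * h τ)
    {N D M : ℕ} [NeZero N] (hNDM : IsAdmissibleFactorization N D M) (X : ShimuraCurveData D M)
    (W : WeierstrassCurve ℚ) [W.IsElliptic] [W.IsGloballyMinimal] (hN : W.conductorNorm ℤ = N)
    (hmod : Nonempty (ModularParametrizationData W N)) :
    Nonempty (ShimuraParametrizationData X W) := by
  obtain ⟨D₁⟩ := hmod
  rcases Nat.lt_or_ge 1 D with hD | hD
  · obtain ⟨h, hh, hper, hhecke⟩ := hJL hNDM hD X W hN D₁.isNeronLattice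
    exact ShimuraParametrizationData.nonempty_of_eigenform X W hD D₁.isNeronLattice h hh hper hhecke
  · obtain rfl : D = 1 := le_antisymm hD hNDM.pos_left
    exact nonempty_shimuraParametrizationData_one_of_modularParametrizationData' hNDM X W D₁

/-- **The fact from its relative form and the Modularity theorem with an integral Manin constant**
(`nonempty_modularParametrizationData`, BCDT Thm. A with Edixhoven: a modular parametrisation
datum of every globally minimal elliptic `W` at level `N_W`): "the absolute form is the relative one
applied to `nonempty_modularParametrizationData`" (review of 2026-08-16).
[cite: PastenShimura2024, §2 p. 12] [cite: BCDTJAMS2001, Thm. A] -/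
theorem nonempty_shimuraParametrizationData_of_relative
    (hR : ∀ {N D M : ℕ} [NeZero N], IsAdmissibleFactorization N D M →
      ∀ (X : ShimuraCurveData D M) (W : WeierstrassCurve ℚ) [W.IsElliptic] [W.IsGloballyMinimal],
        W.conductorNorm ℤ = N → Nonempty (ModularParametrizationData W N) →
        Nonempty (ShimuraParametrizationData X W))
    (hmod : nonempty_modularParametrizationData) : nonempty_shimuraParametrizationData := by
  intro N D M hNDM X W _ _ hN
  subst hN
  haveI : NeZero (W.conductorNorm ℤ) := ⟨hNDM.pos.ne'⟩
  exact hR hNDM X W rfl (hmod W)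

/-- **The fact from its relative form and the Modularity theorem** "Version `L`"
(`exists_isNewformOf`, Diamond–Shurman Thm. 8.8.3; BCDT Thm. A): the modular parametrisation datum
is supplied by the tree's `nonempty_modularParametrizationData_of_exists_isNewformOf` with the
discharged `IsNewformOf.exists_maninConstant_ne_zero_holds` (Eichler–Shimura, Faltings, the
degree of `X₀(N) → ℂ/Λ` being theorems of the tree). Hence the named fact
`nonempty_shimuraParametrizationData` is the Modularity theorem plus its relative form — and the
relative form is proved at `D = 1` and equals the Jacquet–Langlands eigenform statement at `D > 1`
(`relative_of_eigenform`). [cite: DiamondShurman2005, Thm. 8.8.3] [cite: PastenShimura2024, §2 p. 12] -/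
theorem nonempty_shimuraParametrizationData_of_relative_of_exists_isNewformOf
    (hR : ∀ {N D M : ℕ} [NeZero N], IsAdmissibleFactorization N D M →
      ∀ (X : ShimuraCurveData D M) (W : WeierstrassCurve ℚ) [W.IsElliptic] [W.IsGloballyMinimal],
        W.conductorNorm ℤ = N → Nonempty (ModularParametrizationData W N) →
        Nonempty (ShimuraParametrizationData X W))
    (hmod : exists_isNewformOf) : nonempty_shimuraParametrizationData :=
  nonempty_shimuraParametrizationData_of_relative hR
    (nonempty_modularParametrizationData_of_exists_isNewformOf hmod
      IsNewformOf.exists_maninConstant_ne_zero_holds)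

/-- Conversely the fact implies its relative form (the modular parametrisation hypothesis is simply
dropped). [folklore] -/
theorem relative_of_nonempty_shimuraParametrizationData (hP : nonempty_shimuraParametrizationData)
    {N D M : ℕ} [NeZero N] (hNDM : IsAdmissibleFactorization N D M) (X : ShimuraCurveData D M)
    (W : WeierstrassCurve ℚ) [W.IsElliptic] [W.IsGloballyMinimal] (hN : W.conductorNorm ℤ = N)
    (_hmod : Nonempty (ModularParametrizationData W N)) :
    Nonempty (ShimuraParametrizationData X W) :=
  hP hNDM X W hN

end Relative

end Literature.NumberTheory.Automorphic

end
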